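import Summits.BirchSwinnertonDyer.Rank1Residual.X11b.CastellaErratumVersionOfRecord
import HarnessLib

/-!
# Route `ErratumRoadFive`, crux `IMCDivAtErratumDataAll` (item stmt-BirchSwinnertonDyer-19270),
# stub `stub_imcDivErratum_nonsplitAtP` (S1, `a_p = −1`): SCOPE LEMMAS for the BASE-CHANGE road —
# at every erratum datum the two printed hypotheses of the ordinary-to-Greenberg transfer brick
# ("`p ∤ 2N`" and "`(D_K, N) = 1`") FAIL, kernel-checked

Cell `bsd-stepL` (run/shared/lean/pub/bsd-stepL/), seat `bsd-stepL-imc24a` (PART 1b ACCEL seat (1),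
plan g25 ACCEL-LIST: «base-change JSW17 … IMC to the erratum datum, ♭-normalised (BCS25 road)»).
HONEST FRAMING: nothing here proves or refutes the crux; no BSD statement is touched; these are
ELEMENTARY scope lemmas (no named fact, no `sorry`) recording, in the kernel, WHY the only printed
ordinary-to-Greenberg transfer over an imaginary quadratic field — Burungale–Skinner–Tian–Wan,
*Zeta elements for elliptic curves and applications*, arXiv:2409.01350, Prop. 1.18 (§1.3.2: "Let
`g ∈ S_2(Γ_0(N))` be an elliptic newform and `p ∤ 2N` an ordinary or a supersingular prime. Let `L`
be an imaginary quadratic field satisfying the conditions (ord), (coprime) [`(D_L, N) = 1`,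
display before Lemma 1.17] and (van_L) …"), the brick (R4) of the base-change architecture of
Burungale–Castella–Skinner 2025 (arXiv:2405.00270 Thm. 4.1.3 / Cor. 4.1.4 ⇐ [BSTW, §9.3.2]) — is
INAPPLICABLE AS PRINTED at the data of this stub: an erratum datum of route R1 sits at a
multiplicative `p` (`p ∣ N`, hypothesis `Mult W p` of `ErratumHypotheses W p`) and at an erratum
FIELD `K` for the non-split multiplicative witness `q` (`IsErratumField W K q`: `q ∣ d_K`, whereas
`q ∣ N`), so BOTH "`p ∤ 2N`" and "`(D_K, N) = 1`" fail. The seat's memo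
(`MEMO-imc24a-basechange.md`, item evidence on stmt-BirchSwinnertonDyer-19270) carries the full
brick table; this file is its kernel-visible part. The classical-data precedent (every `ℓ ∣ N`
split, `(D_K, N) = 1` automatic) is the cell's PROOF-BDP §30, where only "`p ∤ N`" fails.

## Contents (all PROVED, elementary)

* `IsErratumField.natCast_dvd_discr_and_dvd_conductorNorm` — `q ∣ d_K` and `q ∣ N_E` at an erratum
  field for a multiplicative `q`.
* `IsErratumField.not_isCoprime_discr_conductorNorm` — hence `d_K` and `N_E` are NOT coprime
  (BSTW's (coprime) fails); `IsErratumField.gcd_discr_conductorNorm_ne_one` — the `gcd` spelling.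
* `erratumDatum_transferHypotheses_fail` — at a pair on the erratum's A′-hypotheses with an erratum
  field for a multiplicative `q`: `p ∣ N_E` AND `¬ IsCoprime d_K N_E` (both printed hypotheses of
  BSTW Prop. 1.18 fail at once).

References: [BurungaleSkinnerTianWan2024] Prop. 1.18, display (coprime) before Lemma 1.17
(arXiv:2409.01350 §1.3.1–1.3.2); [BurungaleCastellaSkinner2025] Thm. 4.1.3, Cor. 4.1.4, (Heeg)
(arXiv:2405.00270 pp. 3, 8); [Castella2018] §5 choice of `K` (arXiv:1704.06608 p. 12);
[Castella2018Erratum] Thm. 1.1 (iii) (p. 1). Tree: `X11b/CastellaErratum.lean` (`ErratumHypotheses`,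
`IsErratumField`), `X11b/CastellaErratumVersionOfRecord.lean` (`dvd_conductorNorm_of_mult`).
-/

noncomputable section

open scoped Classical

open WeierstrassCurve NumberField
open Literature.NumberTheory.EllipticCurves Literature.NumberTheory.EllipticCurves.Rank1Residual
open Summit.BirchSwinnertonDyer.Rank1Residual Summit.BirchSwinnertonDyer.Rank1Residual.X11b

namespace Summit.BirchSwinnertonDyer.Rank1Residual.X11b

section Scope

variable {W : WeierstrassCurve ℚ} [W.IsElliptic] [W.IsGloballyMinimal] {p : ℕ} [Fact p.Prime]
  {K : Type} [Field K] [NumberField K] {q : ℕ} [Fact q.Prime]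

omit [W.IsGloballyMinimal] [Fact p.Prime] in
/-- **`q ∣ d_K` and `q ∣ N_E` at an erratum field for a multiplicative `q`.** The first is the
defining clause `q ∣ d_K` of `IsErratumField W K q` (Castella 2018 §5: "`q` is ramified in `K`");
the second is "a multiplicative prime divides the conductor" (`dvd_conductorNorm_of_mult`).
[cite: Castella2018, §5 (arXiv:1704.06608 p. 12), choice of K (shape only; nothing asserted)] -/
theorem IsErratumField.natCast_dvd_discr_and_dvd_conductorNorm (hK : IsErratumField W K q)
    (hmq : Mult W q) :
    (q : ℤ) ∣ NumberField.discr K ∧ (q : ℤ) ∣ (W.conductorNorm ℤ : ℤ) :=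
  ⟨hK.2.1, by exact_mod_cast dvd_conductorNorm_of_mult (W := W) hmq⟩

omit [W.IsGloballyMinimal] [Fact p.Prime] in
/-- **BSTW's hypothesis (coprime) "`(D_L, N) = 1`" FAILS at every erratum field**: for `K` an erratum
field of `W` for a multiplicative prime `q`, the discriminant `d_K` and the conductor `N_E` are not
coprime (`q` divides both). So the printed ordinary-to-Greenberg transfer (arXiv:2409.01350 Prop.
1.18, stated under (coprime)) does not apply at erratum data even at a good prime.
[cite: BurungaleSkinnerTianWan2024, Prop. 1.18 and display (coprime) before Lemma 1.17 (arXiv:2409.01350 §1.3.1–1.3.2) (hypothesis shape only; nothing asserted)] -/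
theorem IsErratumField.not_isCoprime_discr_conductorNorm (hK : IsErratumField W K q)
    (hmq : Mult W q) : ¬ IsCoprime (NumberField.discr K) (W.conductorNorm ℤ : ℤ) := by
  intro h
  obtain ⟨hd, hN⟩ := hK.natCast_dvd_discr_and_dvd_conductorNorm hmq
  have hunit : IsUnit (q : ℤ) := h.isUnit_of_dvd' hd hN
  have hq1 : (q : ℤ).natAbs = 1 := Int.isUnit_iff_natAbs_eq.mp hunit
  rw [Int.natAbs_natCast] at hq1
  exact (Fact.out : q.Prime).one_lt.ne' hq1

omit [W.IsGloballyMinimal] [Fact p.Prime] in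
/-- The `gcd` spelling of the previous lemma: `gcd(d_K, N_E) ≠ 1` at an erratum field for a
multiplicative `q`. [cite: BurungaleSkinnerTianWan2024, display (coprime) before Lemma 1.17 (arXiv:2409.01350 §1.3.1) (hypothesis shape only; nothing asserted)] -/
theorem IsErratumField.gcd_discr_conductorNorm_ne_one (hK : IsErratumField W K q)
    (hmq : Mult W q) : Int.gcd (NumberField.discr K) (W.conductorNorm ℤ : ℤ) ≠ 1 := fun h ↦
  hK.not_isCoprime_discr_conductorNorm hmq (Int.isCoprime_iff_gcd_eq_one.mpr h)

/-- **Both printed hypotheses of the transfer brick fail at an erratum datum.** On the erratum's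
A′-hypotheses at `(W, p)` (`ErratumHypotheses W p`: `5 ≤ p`, `Mult W p`, `Irr W p`, A′-locus) and at
an erratum field `K` for a multiplicative `q`: `p ∣ N_E` (so "`p ∤ 2N`" fails) and `d_K`, `N_E` are
not coprime (so "(coprime)" fails). This is the kernel form of the seat's finding that the
base-change road's brick (R4) = BSTW Prop. 1.18 (⇐ [BSTW §9.3.2], used by BCS25 Thm. 4.1.3) has no
printed form at ANY datum of stub `stub_imcDivErratum_nonsplitAtP` (nor of its split twin).
[cite: BurungaleSkinnerTianWan2024, Prop. 1.18 (arXiv:2409.01350 §1.3.2) (hypothesis shape only; nothing asserted)]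
[cite: BurungaleCastellaSkinner2025, Thm. 4.1.3 and Cor. 4.1.4 (arXiv:2405.00270 p. 8) (shape only; nothing asserted)] -/
theorem erratumDatum_transferHypotheses_fail (hE : ErratumHypotheses W p) (hK : IsErratumField W K q)
    (hmq : Mult W q) :
    p ∣ W.conductorNorm ℤ ∧ ¬ IsCoprime (NumberField.discr K) (W.conductorNorm ℤ : ℤ) :=
  ⟨dvd_conductorNorm_of_mult (W := W) hE.2.1, hK.not_isCoprime_discr_conductorNorm hmq⟩

end Scope

end Summit.BirchSwinnertonDyer.Rank1Residual.X11b

end
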